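import Summits.KontsevichZagierPeriods.KontsevichZagierPeriods.Theorems.SoloBlindLevelEight
import HarnessLib

/-!
# Level 10: duplication and mixed duplication collapse `V₁₀` to five generators

At level `10` the sixteen `S₃`-orbits of exponent triples form FOUR Deligne–Koblitz–Ogus classes:

* `I   = {1,1,8} ∪ {1,4,5} ∪ {2,4,4} ∪ {1,2,7}` (generator `β(1/10,1/10)`),
* `II  = {2,2,6} ∪ {2,3,5} ∪ {3,3,4} ∪ {1,3,6}` (generator `β(1/5,1/5)`),
* `III = {2,9,9} ∪ {5,6,9} ∪ {6,6,8} ∪ {3,8,9}` (generator `β(9/10,9/10)`),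
* `IV  = {4,8,8} ∪ {5,7,8} ∪ {6,7,7} ∪ {4,7,9}` (generator `β(4/5,4/5)`).

Inside the Kontsevich–Zagier rules the first three members of each class are joined by Legendre
duplication `β(a,a) ∝ β(a,½)` and the orbit moves, and the fourth by the MIXED duplication
`β(a,a+½) ∝ β(2a,½)` (`SoloBlindMixedDuplication`) at `a = 1/5, 1/10, 3/10, 2/5` respectively.
`levelSpan_ten_eq`: `V₁₀ = ⟨x_π, β(1/10,1/10), β(1/5,1/5), β(9/10,9/10), β(4/5,4/5)⟩`;
`kz_levelTen`: linear independence of the five periods over `K₀` (Wolfart–Wüstholz) implies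
injectivity of the period map on `V₁₀`.
-/

noncomputable section

open Set

namespace Summit.KontsevichZagierPeriods.KontsevichZagierPeriods.Theorems

namespace SoloBlind

open Literature.NumberTheory.Transcendental
open Literature.NumberTheory.Transcendental.KZ

/-- Orbit representatives at level 10 (one pair per `S₃`-orbit, chosen at the ends of the chains
below). -/
def reps10 : Finset (ℕ × ℕ) :=
  {(1, 1), (1, 4), (4, 4), (2, 7), (2, 2), (2, 5), (3, 3), (1, 6), (9, 9), (9, 5), (6, 6), (3, 8),
    (8, 8), (8, 5), (7, 7), (4, 9)}

/-- `reps10` meets all sixteen `S₃`-orbits at level 10. -/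
theorem represents10 : Represents 10 reps10 := by decide

/-- The five level-10 generators `x_π, β(1/10,1/10), β(1/5,1/5), β(9/10,9/10), β(4/5,4/5)`. -/
def tenGens : Fin 5 → Q :=
  ![xPi, betaQ (1 / 10) (1 / 10), betaQ (1 / 5) (1 / 5), betaQ (9 / 10) (9 / 10),
    betaQ (4 / 5) (4 / 5)]

/-- The span of the five generators. -/
def tenSpan : Submodule K₀ Q := Submodule.span K₀ (range tenGens)

/-- `β(1/10,1/10) ∈ ⟨tenGens⟩`. -/
theorem t11_mem : betaQ (1 / 10) (1 / 10) ∈ tenSpan := Submodule.subset_span ⟨1, rfl⟩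

/-- `β(1/5,1/5) ∈ ⟨tenGens⟩`. -/
theorem t22_mem : betaQ (1 / 5) (1 / 5) ∈ tenSpan := Submodule.subset_span ⟨2, rfl⟩

/-- `β(9/10,9/10) ∈ ⟨tenGens⟩`. -/
theorem t99_mem : betaQ (9 / 10) (9 / 10) ∈ tenSpan := Submodule.subset_span ⟨3, rfl⟩

/-- `β(4/5,4/5) ∈ ⟨tenGens⟩`. -/
theorem t88_mem : betaQ (4 / 5) (4 / 5) ∈ tenSpan := Submodule.subset_span ⟨4, rfl⟩

/-- `β(1/10,1/2) ∈ ⟨tenGens⟩` (duplication at `1/10`). -/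
theorem t15_mem : betaQ (1 / 10) (1 / 2) ∈ tenSpan :=
  (betaQ_propTo_dupl (a := 1 / 10) (by norm_num)).symm.mem t11_mem

/-- `β(1/10,2/5) ∈ ⟨tenGens⟩` (orbit `{1,4,5}`). -/
theorem t14_mem : betaQ (1 / 10) (2 / 5) ∈ tenSpan := by
  have h := propTo_of_sameOrbit (N := 10) (p := (1, 5)) (q := (1, 4)) (by decide) (by decide)
    (by decide)
  norm_num at h
  exact h.mem t15_mem

/-- `β(2/5,1/2) ∈ ⟨tenGens⟩` (orbit `{1,4,5}`). -/
theorem t45_mem : betaQ (2 / 5) (1 / 2) ∈ tenSpan := by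
  have h := propTo_of_sameOrbit (N := 10) (p := (1, 5)) (q := (4, 5)) (by decide) (by decide)
    (by decide)
  norm_num at h
  exact h.mem t15_mem

/-- `β(2/5,2/5) ∈ ⟨tenGens⟩` (duplication at `2/5`). -/
theorem t44_mem : betaQ (2 / 5) (2 / 5) ∈ tenSpan :=
  (betaQ_propTo_dupl (a := 2 / 5) (by norm_num)).mem t45_mem

/-- `β(1/5,7/10) ∈ ⟨tenGens⟩` (MIXED duplication at `1/5`: `{1,2,7}` joins class I). -/
theorem t27_mem : betaQ (1 / 5) (7 / 10) ∈ tenSpan := by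
  have h := betaQ_propTo_mixed (a := 1 / 5) (by norm_num)
  norm_num at h
  exact h.mem t45_mem

/-- `β(1/5,1/2) ∈ ⟨tenGens⟩` (duplication at `1/5`). -/
theorem t25_mem : betaQ (1 / 5) (1 / 2) ∈ tenSpan :=
  (betaQ_propTo_dupl (a := 1 / 5) (by norm_num)).symm.mem t22_mem

/-- `β(3/10,1/2) ∈ ⟨tenGens⟩` (orbit `{2,3,5}`). -/
theorem t35_mem : betaQ (3 / 10) (1 / 2) ∈ tenSpan := by
  have h := propTo_of_sameOrbit (N := 10) (p := (2, 5)) (q := (3, 5)) (by decide) (by decide)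
    (by decide)
  norm_num at h
  exact h.mem t25_mem

/-- `β(3/10,3/10) ∈ ⟨tenGens⟩` (duplication at `3/10`). -/
theorem t33_mem : betaQ (3 / 10) (3 / 10) ∈ tenSpan :=
  (betaQ_propTo_dupl (a := 3 / 10) (by norm_num)).mem t35_mem

/-- `β(1/10,3/5) ∈ ⟨tenGens⟩` (MIXED duplication at `1/10`: `{1,3,6}` joins class II). -/
theorem t16_mem : betaQ (1 / 10) (3 / 5) ∈ tenSpan := by
  have h := betaQ_propTo_mixed (a := 1 / 10) (by norm_num)
  norm_num at h
  exact h.mem t25_mem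

/-- `β(9/10,1/2) ∈ ⟨tenGens⟩` (duplication at `9/10`). -/
theorem t95_mem : betaQ (9 / 10) (1 / 2) ∈ tenSpan :=
  (betaQ_propTo_dupl (a := 9 / 10) (by norm_num)).symm.mem t99_mem

/-- `β(3/5,1/2) ∈ ⟨tenGens⟩` (orbit `{5,6,9}`). -/
theorem t65_mem : betaQ (3 / 5) (1 / 2) ∈ tenSpan := by
  have h := propTo_of_sameOrbit (N := 10) (p := (9, 5)) (q := (6, 5)) (by decide) (by decide)
    (by decide)
  norm_num at h
  exact h.mem t95_mem

/-- `β(3/5,3/5) ∈ ⟨tenGens⟩` (duplication at `3/5`). -/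
theorem t66_mem : betaQ (3 / 5) (3 / 5) ∈ tenSpan :=
  (betaQ_propTo_dupl (a := 3 / 5) (by norm_num)).mem t65_mem

/-- `β(3/10,4/5) ∈ ⟨tenGens⟩` (MIXED duplication at `3/10`: `{3,8,9}` joins class III). -/
theorem t38_mem : betaQ (3 / 10) (4 / 5) ∈ tenSpan := by
  have h := betaQ_propTo_mixed (a := 3 / 10) (by norm_num)
  norm_num at h
  exact h.mem t65_mem

/-- `β(4/5,1/2) ∈ ⟨tenGens⟩` (duplication at `4/5`). -/
theorem t85_mem : betaQ (4 / 5) (1 / 2) ∈ tenSpan :=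
  (betaQ_propTo_dupl (a := 4 / 5) (by norm_num)).symm.mem t88_mem

/-- `β(7/10,1/2) ∈ ⟨tenGens⟩` (orbit `{5,7,8}`). -/
theorem t75_mem : betaQ (7 / 10) (1 / 2) ∈ tenSpan := by
  have h := propTo_of_sameOrbit (N := 10) (p := (8, 5)) (q := (7, 5)) (by decide) (by decide)
    (by decide)
  norm_num at h
  exact h.mem t85_mem

/-- `β(7/10,7/10) ∈ ⟨tenGens⟩` (duplication at `7/10`). -/
theorem t77_mem : betaQ (7 / 10) (7 / 10) ∈ tenSpan :=
  (betaQ_propTo_dupl (a := 7 / 10) (by norm_num)).mem t75_mem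

/-- `β(2/5,9/10) ∈ ⟨tenGens⟩` (MIXED duplication at `2/5`: `{4,7,9}` joins class IV). -/
theorem t49_mem : betaQ (2 / 5) (9 / 10) ∈ tenSpan := by
  have h := betaQ_propTo_mixed (a := 2 / 5) (by norm_num)
  norm_num at h
  exact h.mem t85_mem

/-- Every generator of the orbit description of `V₁₀` lies in `⟨tenGens⟩`. -/
theorem levelGens_ten_mem (i : Option ↥reps10) : levelGens 10 reps10 i ∈ tenSpan := by
  rcases i with _ | ⟨⟨k, l⟩, hr⟩
  · exact Submodule.subset_span ⟨0, rfl⟩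
  · simp only [reps10, Finset.mem_insert, Finset.mem_singleton, Prod.mk.injEq] at hr
    simp only [levelGens]
    rcases hr with ⟨rfl, rfl⟩ | ⟨rfl, rfl⟩ | ⟨rfl, rfl⟩ | ⟨rfl, rfl⟩ | ⟨rfl, rfl⟩ | ⟨rfl, rfl⟩ |
      ⟨rfl, rfl⟩ | ⟨rfl, rfl⟩ | ⟨rfl, rfl⟩ | ⟨rfl, rfl⟩ | ⟨rfl, rfl⟩ | ⟨rfl, rfl⟩ | ⟨rfl, rfl⟩ |
      ⟨rfl, rfl⟩ | ⟨rfl, rfl⟩ | ⟨rfl, rfl⟩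
    · norm_num; exact t11_mem
    · norm_num; exact t14_mem
    · norm_num; exact t44_mem
    · norm_num; exact t27_mem
    · norm_num; exact t22_mem
    · norm_num; exact t25_mem
    · norm_num; exact t33_mem
    · norm_num; exact t16_mem
    · norm_num; exact t99_mem
    · norm_num; exact t95_mem
    · norm_num; exact t66_mem
    · norm_num; exact t38_mem
    · norm_num; exact t88_mem
    · norm_num; exact t85_mem
    · norm_num; exact t77_mem
    · norm_num; exact t49_mem

/-- **`V₁₀ ⊆ ⟨x_π, β(1/10,1/10), β(1/5,1/5), β(9/10,9/10), β(4/5,4/5)⟩`.** -/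
theorem levelSpan_ten_le : levelSpan 10 ≤ tenSpan := by
  rw [levelSpan_eq (by norm_num) represents10]
  exact Submodule.span_le.mpr (by rintro x ⟨i, rfl⟩; exact levelGens_ten_mem i)

/-- The five generators lie in `V₁₀`, so `V₁₀` IS their span. -/
theorem levelSpan_ten_eq : levelSpan 10 = tenSpan := by
  refine le_antisymm levelSpan_ten_le (Submodule.span_le.mpr ?_)
  rintro x ⟨i, rfl⟩
  fin_cases i
  · exact Submodule.subset_span (mem_insert _ _)
  · exact Submodule.subset_span (mem_insert_of_mem _ ⟨1, 1, 0, 0, le_rfl, by norm_num, le_rfl,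
      by norm_num, by norm_num [tenGens]⟩)
  · exact Submodule.subset_span (mem_insert_of_mem _ ⟨2, 2, 0, 0, by norm_num, by norm_num,
      by norm_num, by norm_num, by norm_num [tenGens]⟩)
  · exact Submodule.subset_span (mem_insert_of_mem _ ⟨9, 9, 0, 0, by norm_num, by norm_num,
      by norm_num, by norm_num, by norm_num [tenGens]⟩)
  · exact Submodule.subset_span (mem_insert_of_mem _ ⟨8, 8, 0, 0, by norm_num, by norm_num,
      by norm_num, by norm_num, by norm_num [tenGens]⟩)

/-- **Level 10.** If `π, B(1/10,1/10), B(1/5,1/5), B(9/10,9/10), B(4/5,4/5)` are linearly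
independent over `K₀ = ℚ̄ ∩ ℝ` (Wolfart–Wüstholz), then the period map is injective on `V₁₀`:
every `K₀`-linear relation among level-10 Beta words and `π` with vanishing period follows from
the three Kontsevich–Zagier rules. -/
theorem kz_levelTen (h : LinearIndependent K₀ fun i => evalQ (tenGens i)) {z : Q}
    (hz : z ∈ levelSpan 10) (h0 : evalQ z = 0) : z = 0 := by
  obtain ⟨c, rfl⟩ := (Submodule.mem_span_range_iff_exists_fun K₀).mp (levelSpan_ten_le hz)
  have hsum : ∑ i, c i • evalQ (tenGens i) = 0 := by
    rw [map_sum] at h0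
    simpa only [evalQ_smul, IntermediateField.smul_def, smul_eq_mul] using h0
  have hc : ∀ i, c i = 0 := Fintype.linearIndependent_iff.mp h c hsum
  simp [hc]

/-- The period map is injective on `V₁₀` (same hypothesis). -/
theorem evalQ_injOn_levelSpan_ten (h : LinearIndependent K₀ fun i => evalQ (tenGens i)) :
    InjOn evalQ (levelSpan 10) := fun x hx y hy hxy => sub_eq_zero.mp
  (kz_levelTen h ((levelSpan 10).sub_mem hx hy) (by rw [map_sub, hxy, sub_self]))

end SoloBlind

end Summit.KontsevichZagierPeriods.KontsevichZagierPeriods.Theorems
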